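import Mathlib.NumberTheory.PrimeCounting
import Mathlib.Data.ZMod.Basic
import Mathlib.Topology.Algebra.InfiniteSum.Basic
import Mathlib.NumberTheory.SmoothNumbers
import Mathlib.Analysis.SpecificLimits.Basic
import Mathlib.Analysis.SpecialFunctions.Log.Summable
import Mathlib.Analysis.PSeries
import HarnessLib

-- provenance: harness21/H21/H21/Prelude/AntSieve/SingularSeries.lean @ efa73f9 (interim HEAD d8f2665); M5 mechanical rewrite
/-!
# Admissible tuples and Hardy–Littlewood singular series

Trunk T-ANT / T-SIEVE (outline `AntSieve.md`, §C10, design decision D-SIEVE-1), notion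
`singular_series`.

We define

* `Literature.tupleResidueCount H p` — `ν_H(p)`, the number of residue classes mod `p` occupied by a
  finite tuple `H ⊆ ℤ`;
* `Literature.IsAdmissibleTuple H` — `H` misses a residue class modulo every prime;
* `Literature.NumberTheory.Sieve.singularSeriesFactor`, `Literature.NumberTheory.Sieve.singularSeriesPartial`, `Literature.NumberTheory.Sieve.singularSeries` — the Euler factor
  `(1 - ν_H(p)/p) (1 - 1/p)^{-k}`, its ordered partial products over `p ≤ x` and the
  Hardy–Littlewood singular series `𝔖(H) = lim_{x → ∞} ∏_{p ≤ x} …`;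
* `Literature.NumberTheory.Sieve.twinPrimeConstPartial`, `Literature.NumberTheory.Sieve.twinPrimeConst` — the twin prime constant
  `C₂ = ∏_{p > 2} (1 - 1/(p-1)²)`;
* `Literature.goldbachSingularSeries N` — the binary Goldbach singular series
  `𝔖(N) = 2 C₂ ∏_{p ∣ N, p > 2} (p-1)/(p-2)` (`0` for odd `N`);
* `Literature.ternaryGoldbachSingularSeries N` — Vinogradov's `𝔖₃(N)`;
* counting functions `Literature.NumberTheory.Sieve.primeTupleCount`, `Literature.NumberTheory.Sieve.twinPrimeCount`, `Literature.NumberTheory.Sieve.SingularSeries.goldbachCount`.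

Mathlib (at the pinned commit) has none of these (searched `singularSeries`, `twinPrime`,
`Admissible`); it provides the anchors `Nat.primesLE`, `Filter.limUnder`, `Nat.Primes`, `HasProd`,
`ZMod`, `Finset.antidiagonal` used here.

## Design choices

* (D-SIEVE-1) The products defining `𝔖(H)` and `C₂` are only conditionally convergent in general
  when split into their two factors, so they are defined as *ordered* limits of partial products
  over `Nat.primesLE x` via `Filter.limUnder atTop`, each paired with a `Tendsto` lemma. For the
  combined factor `singularSeriesFactor H p = 1 + O(p⁻²)` the product is absolutely convergent and
  we also record the `HasProd` bridge over `Nat.Primes`.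
* `goldbachSingularSeries` casts to `ℝ` before subtracting (`(p:ℝ) - 2`), avoiding `ℕ`-subtraction.
* `ternaryGoldbachSingularSeries` is absolutely convergent, so `∏'` over `Nat.Primes` is used.
* `goldbachCount` has the byte-identical body of the accepted `Literature.NumberTheory.Sieve.ParityWave0.goldbachCount`
  (`Statements/Parity/Wave0.lean`; ordered pairs on `antidiagonal N`, no `ℕ`-subtraction); the
  `rfl` bridge lives in `Statements/Parity/HardyLittlewood.lean`.
* `primeTupleCount` counts `1 ≤ n ≤ x` with every `n + h` a positive prime; the tuple lives in `ℤ`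
  and positivity is demanded explicitly, so `Int.toNat` never produces junk primes.

## References

* G. H. Hardy, J. E. Littlewood, *Some problems of 'Partitio Numerorum' III: On the expression of
  a number as a sum of primes*, Acta Math. 44 (1923), 1–70 (Conjectures A, B, singular series).
* H. Halberstam, H.-E. Richert, *Sieve Methods*, Academic Press 1974, ch. 10.
* I. M. Vinogradov, *Representation of an odd number as a sum of three primes*, Dokl. Akad. Nauk
  SSSR 15 (1937), 291–294; R. C. Vaughan, *The Hardy–Littlewood Method*, 2nd ed., Thm 3.4.
-/

noncomputable section

open Filter Finset
open scoped Topology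

namespace Literature.NumberTheory.Sieve

/-! ### Admissible tuples -/

/-- `ν_H(p)`: the number of distinct residue classes modulo `p` occupied by the finite tuple
`H ⊆ ℤ`. (For `p = 0`, `ZMod 0 = ℤ` and this is `#H`.) Halberstam–Richert, *Sieve Methods*,
ch. 10; Hardy–Littlewood 1923. [cite: HardyLittlewood1923] -/
def tupleResidueCount (H : Finset ℤ) (p : ℕ) : ℕ :=
  (H.image fun h : ℤ ↦ (h : ZMod p)).card

/-- A finite tuple `H ⊆ ℤ` is *admissible* if for every prime `p` it misses at least one residue
class mod `p`, i.e. `ν_H(p) < p`. Hardy–Littlewood 1923; Halberstam–Richert ch. 10. [cite: HardyLittlewood1923] -/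
def IsAdmissibleTuple (H : Finset ℤ) : Prop :=
  ∀ p : ℕ, p.Prime → tupleResidueCount H p < p

/-- `ν_H(p) ≤ k = #H`. Halberstam–Richert ch. 10. [folklore] -/
theorem tupleResidueCount_le_card (H : Finset ℤ) (p : ℕ) : tupleResidueCount H p ≤ H.card :=
  Finset.card_image_le

/-- If all pairwise differences of `H` are `< p` in absolute value (in particular if `p` exceeds
the diameter of `H`), the elements of `H` are pairwise incongruent mod `p`, so `ν_H(p) = k`.
Halberstam–Richert ch. 10. [cite: HalberstamRichert1974, Ch. 10] -/
def tupleResidueCount_eq_card_of_lt : Prop :=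
  ∀ (H : Finset ℤ) (p : ℕ) (h : ∀ a ∈ H, ∀ b ∈ H, |a - b| < p),
    tupleResidueCount H p = H.card

/-- Admissibility is a finite check: only primes `p ≤ k = #H` can have all residue classes
covered, since `ν_H(p) ≤ k < p` otherwise. Halberstam–Richert ch. 10. [folklore] -/
theorem isAdmissibleTuple_iff_of_le_card (H : Finset ℤ) :
    IsAdmissibleTuple H ↔ ∀ p : ℕ, p.Prime → p ≤ H.card → tupleResidueCount H p < p := by
  refine ⟨fun h p hp _ ↦ h p hp, fun h p hp ↦ ?_⟩
  by_cases hle : p ≤ H.card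
  · exact h p hp hle
  · exact (tupleResidueCount_le_card H p).trans_lt (not_le.mp hle)

/-- The twin-prime tuple `{0, 2}` is admissible. Hardy–Littlewood 1923. [cite: HardyLittlewood1923] -/
theorem isAdmissibleTuple_pair : IsAdmissibleTuple ({0, 2} : Finset ℤ) := by
  rw [isAdmissibleTuple_iff_of_le_card]
  intro p hp hle
  obtain rfl : p = 2 := le_antisymm (hle.trans (by decide)) hp.two_le
  decide

/-! ### The Hardy–Littlewood singular series -/

/-- The Euler factor of the Hardy–Littlewood singular series at `p`:
`(1 - ν_H(p)/p) · (1 - 1/p)^{-k}` with `k = #H`. (Junk for `p = 0, 1`.) Hardy–Littlewood 1923;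
Halberstam–Richert ch. 10, (10.1.4). [cite: HardyLittlewood1923] -/
def singularSeriesFactor (H : Finset ℤ) (p : ℕ) : ℝ :=
  (1 - (tupleResidueCount H p : ℝ) / p) * (1 - 1 / (p : ℝ))⁻¹ ^ H.card

/-- Ordered partial product `∏_{p ≤ x} (1 - ν_H(p)/p)(1 - 1/p)^{-k}` of the singular series
(D-SIEVE-1). Hardy–Littlewood 1923. [cite: HardyLittlewood1923] -/
def singularSeriesPartial (H : Finset ℤ) (x : ℕ) : ℝ :=
  ∏ p ∈ Nat.primesLE x, singularSeriesFactor H p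

/-- The Hardy–Littlewood singular series
`𝔖(H) = ∏_p (1 - ν_H(p)/p)(1 - 1/p)^{-k} = lim_{x → ∞} ∏_{p ≤ x} …`, as an ordered limit
(D-SIEVE-1; the limit exists by `tendsto_singularSeriesPartial`). Hardy–Littlewood 1923,
Conjecture B; Halberstam–Richert ch. 10. [cite: HardyLittlewood1923, Conjecture B] -/
def singularSeries (H : Finset ℤ) : ℝ :=
  limUnder atTop (singularSeriesPartial H)

/-- The partial products of the singular series converge (the factors are `1 + O(p⁻²)` since
`ν_H(p) = k` for large `p`). Halberstam–Richert ch. 10. [cite: HalberstamRichert1974, Ch. 10] -/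
def tendsto_singularSeriesPartial : Prop :=
  ∀ (H : Finset ℤ),
    Tendsto (singularSeriesPartial H) atTop (𝓝 (singularSeries H))

/-- Bridge to Mathlib's unordered products: the singular series is absolutely convergent, so
`∏' p : Nat.Primes, singularSeriesFactor H p` converges (as a `HasProd`) to `𝔖(H)`.
Halberstam–Richert ch. 10. [cite: HalberstamRichert1974, Ch. 10] -/
def hasProd_singularSeriesFactor : Prop :=
  ∀ (H : Finset ℤ),
    HasProd (fun p : Nat.Primes ↦ singularSeriesFactor H p) (singularSeries H)

/-- `0 ≤ 𝔖(H)`. Halberstam–Richert ch. 10. [cite: HalberstamRichert1974, Ch. 10] -/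
def singularSeries_nonneg : Prop :=
  ∀ (H : Finset ℤ),
    0 ≤ singularSeries H

/-- `𝔖(H) > 0` if and only if `H` is admissible (otherwise some factor `1 - ν_H(p)/p` vanishes).
Halberstam–Richert, *Sieve Methods*, ch. 10. [cite: HalberstamRichert1974, Ch. 10] -/
def singularSeries_pos_iff : Prop :=
  ∀ (H : Finset ℤ),
    0 < singularSeries H ↔ IsAdmissibleTuple H

/-! ### The twin prime constant and Goldbach singular series -/

/-- Ordered partial product `∏_{2 < p ≤ x} (1 - 1/(p-1)²)` of the twin prime constant
(D-SIEVE-1). Hardy–Littlewood 1923. [cite: HardyLittlewood1923] -/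
def twinPrimeConstPartial (x : ℕ) : ℝ :=
  ∏ p ∈ (Nat.primesLE x).filter (2 < ·), (1 - 1 / ((p : ℝ) - 1) ^ 2)

/-- The twin prime constant `C₂ = ∏_{p > 2} (1 - 1/(p-1)²) ≈ 0.6601…`, as an ordered limit
(D-SIEVE-1). Hardy–Littlewood 1923, (5.311). [cite: HardyLittlewood1923, (5.311] -/
def twinPrimeConst : ℝ :=
  limUnder atTop twinPrimeConstPartial

/-- The partial products of `C₂` converge (decreasing, bounded below by a positive constant).
Hardy–Littlewood 1923. [cite: HardyLittlewood1923] -/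
def tendsto_twinPrimeConstPartial : Prop :=
  Tendsto twinPrimeConstPartial atTop (𝓝 twinPrimeConst)

/-- `0 < C₂`. Hardy–Littlewood 1923. [cite: HardyLittlewood1923] -/
def twinPrimeConst_pos : Prop :=
  0 < twinPrimeConst

/-- `𝔖({0, 2}) = 2 C₂`. Hardy–Littlewood 1923, Conjecture B; Halberstam–Richert ch. 10. [cite: HardyLittlewood1923, Conjecture B] -/
def singularSeries_pair : Prop :=
  singularSeries ({0, 2} : Finset ℤ) = 2 * twinPrimeConst

/-- The binary Goldbach singular series `𝔖(N) = 2 C₂ ∏_{p ∣ N, p > 2} (p-1)/(p-2)` for even `N`,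
and `0` for odd `N`. Casts to `ℝ` precede the subtractions. Hardy–Littlewood 1923,
Conjecture A. [cite: HardyLittlewood1923, Conjecture A] -/
def goldbachSingularSeries (N : ℕ) : ℝ :=
  if Odd N then 0
  else 2 * twinPrimeConst * ∏ p ∈ N.primeFactors.filter (2 < ·), (((p : ℝ) - 1) / ((p : ℝ) - 2))

/-- Vinogradov's ternary Goldbach singular series
`𝔖₃(N) = ∏_p (1 + 1/(p-1)³) · ∏_{p ∣ N} (1 - 1/(p² - 3p + 3))`. The infinite product is
absolutely convergent, so Mathlib's unordered `∏'` over `Nat.Primes` is used. Vinogradov 1937;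
Vaughan, *The Hardy–Littlewood Method*, Thm 3.4. [cite: Vinogradov1937] -/
def ternaryGoldbachSingularSeries (N : ℕ) : ℝ :=
  (∏' p : Nat.Primes, (1 + 1 / (((p : ℕ) : ℝ) - 1) ^ 3)) *
    ∏ p ∈ N.primeFactors, (1 - 1 / ((p : ℝ) ^ 2 - 3 * p + 3))

/-- `𝔖₃(N) > 0` for odd `N` (indeed `𝔖₃(N) ≫ 1` uniformly). Vaughan, *The Hardy–Littlewood
Method*, Thm 3.4. [cite: VaughanHL1997, Thm. 3.4] -/
def ternaryGoldbachSingularSeries_pos : Prop :=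
  ∀ {N : ℕ} (hN : Odd N),
    0 < ternaryGoldbachSingularSeries N

/-! ### Counting functions -/

/-- `π_H(x) = #{1 ≤ n ≤ x : n + h is a (positive) prime for every h ∈ H}`, the prime `k`-tuple
counting function. Hardy–Littlewood 1923, Conjecture B. [cite: HardyLittlewood1923, Conjecture B] -/
def primeTupleCount (H : Finset ℤ) (x : ℕ) : ℕ :=
  #((Icc 1 x).filter fun n : ℕ ↦ ∀ h ∈ H, 0 < (n : ℤ) + h ∧ ((n : ℤ) + h).toNat.Prime)

/-- `π₂(x) = #{p ≤ x : p, p + 2 prime}`, the twin prime counting function.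
Hardy–Littlewood 1923. [cite: HardyLittlewood1923] -/
def twinPrimeCount (x : ℕ) : ℕ :=
  #{p ∈ range (x + 1) | p.Prime ∧ (p + 2).Prime}

/-- The Goldbach representation number `R(N) = #{(p, q) : p, q prime, p + q = N}` (ordered
pairs). Byte-identical to the accepted `Literature.NumberTheory.Sieve.ParityWave0.goldbachCount` (Statements/Parity/Wave0);
Hardy–Littlewood 1923, Conjecture A. [cite: HardyLittlewood1923, Conjecture A] -/
def SingularSeries.goldbachCount (N : ℕ) : ℕ :=
  #{pq ∈ antidiagonal N | pq.1.Prime ∧ pq.2.Prime}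

/-- `π₂(x) = π_{{0,2}}(x)`. Hardy–Littlewood 1923. [cite: HardyLittlewood1923] -/
def twinPrimeCount_eq_primeTupleCount : Prop :=
  ∀ (x : ℕ),
    twinPrimeCount x = primeTupleCount ({0, 2} : Finset ℤ) x

/-! ### Proofs: convergence of the singular series

The Euler factor satisfies `(1 - ν_H(p)/p)(1 - 1/p)^{-k} = 1 + O_k(p⁻²)` because `ν_H(p) = k` as
soon as `p` exceeds the diameter of `H` (Halberstam–Richert, *Sieve Methods*, ch. 10, discussion
of (10.1.4); Hardy–Littlewood 1923, §5). Precisely, for `p > diam H` and `p ≥ k = m + 1` one has,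
with `u = 1/(p-1)`, the identity `(1 - k/p)(1 - 1/p)^{-k} = (1 - m u)(1 + u)^m` and the elementary
bounds `1 - m²u² ≤ (1 - m u)(1 + u)^m ≤ 1` (Bernoulli below, `1 + t ≤ eᵗ` above). Hence
`∑_p |factor - 1| < ∞`, the product is absolutely convergent
(Mathlib `multipliable_one_add_of_summable`), and the ordered partial products converge. -/

section Proofs

/-- Discharge of `tupleResidueCount_eq_card_of_lt`: if all differences of `H` are `< p` in
absolute value then `h ↦ h mod p` is injective on `H`, so `ν_H(p) = #H`.
Halberstam–Richert ch. 10. [cite: HalberstamRichert1974, Ch. 10] -/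
theorem tupleResidueCount_eq_card_of_lt_holds : tupleResidueCount_eq_card_of_lt := by
  intro H p h
  unfold tupleResidueCount
  refine Finset.card_image_of_injOn fun a ha b hb hab ↦ ?_
  have hdvd : (p : ℤ) ∣ b - a := (ZMod.intCast_eq_intCast_iff_dvd_sub a b p).mp hab
  have hlt : |b - a| < (p : ℤ) := h b hb a ha
  have := Int.eq_zero_of_abs_lt_dvd hdvd hlt
  linarith

/-- The elementary inequality behind the convergence of the singular series:
`|(1 - m u)(1 + u)^m - 1| ≤ (m u)²` for `0 ≤ u` and `m u ≤ 1`. [folklore] -/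
theorem abs_one_sub_mul_mul_one_add_pow_sub_one_le (m : ℕ) {u : ℝ} (hu : 0 ≤ u)
    (hmu : (m : ℝ) * u ≤ 1) :
    |(1 - m * u) * (1 + u) ^ m - 1| ≤ ((m : ℝ) * u) ^ 2 := by
  rw [abs_le]
  constructor
  · have h1 : 1 + (m : ℝ) * u ≤ (1 + u) ^ m := one_add_mul_le_pow (by linarith) m
    have h2 : 0 ≤ 1 - (m : ℝ) * u := by linarith
    nlinarith [mul_le_mul_of_nonneg_left h1 h2]
  · have h1 : (1 + u) ^ m ≤ Real.exp ((m : ℝ) * u) := by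
      calc (1 + u) ^ m ≤ (Real.exp u) ^ m :=
            pow_le_pow_left₀ (by linarith) (by linarith [Real.add_one_le_exp u]) m
        _ = Real.exp ((m : ℝ) * u) := (Real.exp_nat_mul u m).symm
    have h2 : 1 - (m : ℝ) * u ≤ Real.exp (-((m : ℝ) * u)) := by
      linarith [Real.add_one_le_exp (-((m : ℝ) * u))]
    have h3 : (1 - (m : ℝ) * u) * (1 + u) ^ m ≤ Real.exp (-((m : ℝ) * u)) * Real.exp (m * u) :=
      mul_le_mul h2 h1 (pow_nonneg (by linarith) m) (Real.exp_pos _).le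
    rw [← Real.exp_add, neg_add_cancel, Real.exp_zero] at h3
    nlinarith [h3, sq_nonneg ((m : ℝ) * u)]

/-- Quantitative form of "the Euler factors are `1 + O_k(p⁻²)`": for all sufficiently large
primes `p`, `|(1 - ν_H(p)/p)(1 - 1/p)^{-k} - 1| ≤ 4k²/p²`. Halberstam–Richert ch. 10.
[cite: HalberstamRichert1974, Ch. 10] -/
theorem exists_abs_singularSeriesFactor_sub_one_le (H : Finset ℤ) :
    ∃ N : ℕ, ∀ p : ℕ, N ≤ p → p.Prime →
      |singularSeriesFactor H p - 1| ≤ 4 * (H.card : ℝ) ^ 2 * ((p : ℝ) ^ 2)⁻¹ := by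
  set B : ℕ := ∑ h ∈ H, h.natAbs with hB
  refine ⟨max (2 * B + 1) H.card, fun p hNp hp ↦ ?_⟩
  have hpB : 2 * B + 1 ≤ p := le_of_max_le_left hNp
  have hpk : H.card ≤ p := le_of_max_le_right hNp
  have hν : tupleResidueCount H p = H.card := by
    refine tupleResidueCount_eq_card_of_lt_holds H p fun a ha b hb ↦ ?_
    have ha' : a.natAbs ≤ B :=
      Finset.single_le_sum (f := fun h : ℤ ↦ h.natAbs) (fun _ _ ↦ Nat.zero_le _) ha
    have hb' : b.natAbs ≤ B :=
      Finset.single_le_sum (f := fun h : ℤ ↦ h.natAbs) (fun _ _ ↦ Nat.zero_le _) hb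
    calc |a - b| ≤ |a| + |b| := abs_sub a b
      _ = (a.natAbs : ℤ) + (b.natAbs : ℤ) := by
          rw [Int.natCast_natAbs, Int.natCast_natAbs]
      _ < p := by omega
  rcases Nat.eq_zero_or_pos H.card with hk | hk
  · have hH : H = ∅ := Finset.card_eq_zero.mp hk
    subst hH
    simp [singularSeriesFactor, tupleResidueCount]
  · obtain ⟨m, hm⟩ : ∃ m, H.card = m + 1 := Nat.exists_eq_succ_of_ne_zero hk.ne'
    have hp2 : (2 : ℝ) ≤ p := by exact_mod_cast hp.two_le
    have hp0 : (p : ℝ) ≠ 0 := by positivity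
    have hq1 : 0 < (p : ℝ) - 1 := by linarith
    have hq1' : (p : ℝ) - 1 ≠ 0 := hq1.ne'
    set u : ℝ := 1 / ((p : ℝ) - 1) with hu
    have hu0 : 0 ≤ u := by positivity
    have hu2 : u ≤ 2 / p := by
      rw [hu, div_le_div_iff₀ hq1 (by linarith)]
      linarith
    have hmq : (m : ℝ) + 1 ≤ p := by exact_mod_cast (show m + 1 ≤ p by omega)
    have hmu : (m : ℝ) * u ≤ 1 := by
      rw [hu, mul_one_div, div_le_one hq1]
      linarith
    have hinv : (1 - 1 / (p : ℝ))⁻¹ = 1 + u := by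
      rw [hu]
      field_simp
      ring
    have hlin : (1 - ((m : ℝ) + 1) / p) * (1 + u) = 1 - m * u := by
      rw [hu]
      field_simp
      ring
    have hfac : singularSeriesFactor H p = (1 - m * u) * (1 + u) ^ m := by
      rw [singularSeriesFactor, hν, hm, hinv, Nat.cast_add_one, pow_succ, ← hlin]
      ring
    rw [hfac]
    have hmle : (m : ℝ) ≤ H.card := by exact_mod_cast (by omega : m ≤ H.card)
    calc |(1 - (m : ℝ) * u) * (1 + u) ^ m - 1| ≤ ((m : ℝ) * u) ^ 2 :=
          abs_one_sub_mul_mul_one_add_pow_sub_one_le m hu0 hmu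
      _ ≤ ((m : ℝ) * (2 / p)) ^ 2 := by gcongr
      _ = 4 * (m : ℝ) ^ 2 * ((p : ℝ) ^ 2)⁻¹ := by
          field_simp
          ring
      _ ≤ 4 * (H.card : ℝ) ^ 2 * ((p : ℝ) ^ 2)⁻¹ := by gcongr

/-- The Euler factor extended by `1` to non-primes, so that the ordered partial products over
`Nat.primesLE x` become partial products over `Finset.range (x + 1)`. [folklore] -/
def singularSeriesFactorNat (H : Finset ℤ) (n : ℕ) : ℝ :=
  if n.Prime then singularSeriesFactor H n else 1

/-- Unfolding lemma for `singularSeriesFactorNat`. [folklore] -/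
theorem singularSeriesFactorNat_def (H : Finset ℤ) (n : ℕ) :
    singularSeriesFactorNat H n = if n.Prime then singularSeriesFactor H n else 1 := rfl

/-- `∏_{p ≤ x} factor(p) = ∏_{n < x + 1} factorNat(n)`. [folklore] -/
theorem singularSeriesPartial_eq_prod_range (H : Finset ℤ) (x : ℕ) :
    singularSeriesPartial H x = ∏ n ∈ range (x + 1), singularSeriesFactorNat H n := by
  rw [singularSeriesPartial, Nat.primesLE_eq_filter_range, Finset.prod_filter]
  rfl

/-- `∑_n |factorNat(n) - 1| < ∞`: the singular series is absolutely convergent.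
Halberstam–Richert ch. 10. [cite: HalberstamRichert1974, Ch. 10] -/
theorem summable_norm_singularSeriesFactorNat_sub_one (H : Finset ℤ) :
    Summable fun n ↦ ‖singularSeriesFactorNat H n - 1‖ := by
  obtain ⟨N, hN⟩ := exists_abs_singularSeriesFactor_sub_one_le H
  refine Summable.of_norm_bounded_eventually_nat
    ((Real.summable_nat_pow_inv.mpr one_lt_two).mul_left (4 * (H.card : ℝ) ^ 2)) ?_
  rw [Filter.eventually_atTop]
  refine ⟨N, fun n hn ↦ ?_⟩
  rw [norm_norm, Real.norm_eq_abs, singularSeriesFactorNat_def]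
  split_ifs with hn'
  · exact hN n hn hn'
  · rw [sub_self, abs_zero]
    positivity

/-- The extended Euler factors form a multipliable family (Mathlib
`multipliable_one_add_of_summable`). Halberstam–Richert ch. 10. [cite: HalberstamRichert1974, Ch. 10] -/
theorem multipliable_singularSeriesFactorNat (H : Finset ℤ) :
    Multipliable (singularSeriesFactorNat H) := by
  have := multipliable_one_add_of_summable (summable_norm_singularSeriesFactorNat_sub_one H)
  simpa using this

/-- The ordered partial products converge to Mathlib's unconditional product
`∏' n, factorNat(n)`. Halberstam–Richert ch. 10. [cite: HalberstamRichert1974, Ch. 10] -/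
theorem tendsto_singularSeriesPartial_tprod (H : Finset ℤ) :
    Tendsto (singularSeriesPartial H) atTop (𝓝 (∏' n, singularSeriesFactorNat H n)) := by
  rw [show singularSeriesPartial H = fun x ↦ ∏ n ∈ range (x + 1), singularSeriesFactorNat H n
    from funext (singularSeriesPartial_eq_prod_range H)]
  exact (multipliable_singularSeriesFactorNat H).tendsto_prod_tprod_nat.comp
    (tendsto_add_atTop_nat 1)

/-- `𝔖(H) = ∏' n, factorNat(n)` (the ordered limit agrees with the unconditional product).
Halberstam–Richert ch. 10. [cite: HalberstamRichert1974, Ch. 10] -/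
theorem singularSeries_eq_tprod (H : Finset ℤ) :
    singularSeries H = ∏' n, singularSeriesFactorNat H n :=
  (tendsto_singularSeriesPartial_tprod H).limUnder_eq

/-- Discharge of `tendsto_singularSeriesPartial`: the ordered partial products of the singular
series converge to `𝔖(H)`. Halberstam–Richert, *Sieve Methods*, ch. 10 (the product (10.1.4)
converges absolutely since its factors are `1 + O_k(p⁻²)`). [cite: HalberstamRichert1974, Ch. 10] -/
theorem tendsto_singularSeriesPartial_holds : tendsto_singularSeriesPartial := by
  intro H
  rw [singularSeries_eq_tprod]
  exact tendsto_singularSeriesPartial_tprod H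

/-- Discharge of `hasProd_singularSeriesFactor`: the unordered product over `Nat.Primes`
converges to `𝔖(H)`. Halberstam–Richert ch. 10. [cite: HalberstamRichert1974, Ch. 10] -/
theorem hasProd_singularSeriesFactor_holds : hasProd_singularSeriesFactor := by
  intro H
  have h : HasProd (singularSeriesFactorNat H) (singularSeries H) := by
    rw [singularSeries_eq_tprod]
    exact (multipliable_singularSeriesFactorNat H).hasProd
  have hone : ∀ n : ℕ, n ∉ Set.range ((↑) : Nat.Primes → ℕ) → singularSeriesFactorNat H n = 1 := by
    intro n hn
    have hn' : ¬ n.Prime := fun hp ↦ hn ⟨⟨n, hp⟩, rfl⟩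
    exact if_neg hn'
  have hfun : (fun p : Nat.Primes ↦ singularSeriesFactor H p) =
      singularSeriesFactorNat H ∘ ((↑) : Nat.Primes → ℕ) := by
    funext p
    simp [singularSeriesFactorNat_def, p.2]
  rw [hfun]
  exact (Nat.Primes.coe_nat_injective.hasProd_iff hone).mpr h

/-- Each Euler factor at a prime is nonnegative: `ν_H(p) ≤ p` and `1 - 1/p ≥ 0`. [folklore] -/
theorem singularSeriesFactor_nonneg (H : Finset ℤ) {p : ℕ} (hp : p.Prime) :
    0 ≤ singularSeriesFactor H p := by
  haveI := Fact.mk hp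
  have hν : (tupleResidueCount H p : ℝ) ≤ p := by
    have : tupleResidueCount H p ≤ Fintype.card (ZMod p) := Finset.card_le_univ _
    rw [ZMod.card] at this
    exact_mod_cast this
  have hp0 : (0 : ℝ) < p := by exact_mod_cast hp.pos
  have hp1 : (1 : ℝ) ≤ p := by exact_mod_cast hp.one_le
  unfold singularSeriesFactor
  refine mul_nonneg ?_ (pow_nonneg (inv_nonneg.mpr ?_) _)
  · rw [sub_nonneg, div_le_one hp0]
    exact hν
  · rw [sub_nonneg, div_le_one hp0]
    exact hp1

/-- Discharge of `singularSeries_nonneg`: `0 ≤ 𝔖(H)` as a limit of nonnegative partial products.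
Halberstam–Richert ch. 10. [cite: HalberstamRichert1974, Ch. 10] -/
theorem singularSeries_nonneg_holds : singularSeries_nonneg := by
  intro H
  refine ge_of_tendsto' (tendsto_singularSeriesPartial_holds H) fun x ↦ ?_
  exact Finset.prod_nonneg fun p hp ↦ singularSeriesFactor_nonneg H (Nat.mem_primesLE.mp hp).2

/-- Each Euler factor at a prime `p` with `ν_H(p) < p` is positive. [folklore] -/
theorem singularSeriesFactor_pos (H : Finset ℤ) {p : ℕ} (hp : p.Prime)
    (hν : tupleResidueCount H p < p) : 0 < singularSeriesFactor H p := by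
  have hp0 : (0 : ℝ) < p := by exact_mod_cast hp.pos
  have hp1 : (1 : ℝ) < p := by exact_mod_cast hp.one_lt
  have hν' : (tupleResidueCount H p : ℝ) < p := by exact_mod_cast hν
  unfold singularSeriesFactor
  refine mul_pos ?_ (pow_pos (inv_pos.mpr ?_) _)
  · rw [sub_pos, div_lt_one hp0]
    exact hν'
  · rw [sub_pos, div_lt_one hp0]
    exact hp1

/-- If `H` covers all residue classes mod a prime `p` (`ν_H(p) = p`), the Euler factor at `p`
vanishes. Halberstam–Richert ch. 10. [cite: HalberstamRichert1974, Ch. 10] -/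
theorem singularSeriesFactor_eq_zero (H : Finset ℤ) {p : ℕ} (hp : p.Prime)
    (hν : p ≤ tupleResidueCount H p) : singularSeriesFactor H p = 0 := by
  haveI := Fact.mk hp
  have hle : tupleResidueCount H p ≤ p := by
    have : tupleResidueCount H p ≤ Fintype.card (ZMod p) := Finset.card_le_univ _
    rwa [ZMod.card] at this
  have heq : tupleResidueCount H p = p := le_antisymm hle hν
  have hp0 : (p : ℝ) ≠ 0 := by exact_mod_cast hp.ne_zero
  simp [singularSeriesFactor, heq, hp0]

/-- Discharge of `singularSeries_pos_iff`: `𝔖(H) > 0 ↔ H` admissible. If `H` is not admissible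
some factor vanishes and the partial products are eventually `0`; if it is, every factor is
positive and `𝔖(H) = exp (∑ log factor) > 0` by absolute convergence.
Halberstam–Richert, *Sieve Methods*, ch. 10. [cite: HalberstamRichert1974, Ch. 10] -/
theorem singularSeries_pos_iff_holds : singularSeries_pos_iff := by
  intro H
  constructor
  · intro hpos
    by_contra hna
    obtain ⟨p, hp, hν⟩ : ∃ p, p.Prime ∧ p ≤ tupleResidueCount H p := by
      simp only [IsAdmissibleTuple] at hna
      push Not at hna
      exact hna
    have hzero : ∀ x ≥ p, singularSeriesPartial H x = 0 := fun x hx ↦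
      Finset.prod_eq_zero (Nat.mem_primesLE.mpr ⟨hx, hp⟩) (singularSeriesFactor_eq_zero H hp hν)
    have hlim : Tendsto (singularSeriesPartial H) atTop (𝓝 0) :=
      tendsto_const_nhds.congr' (by
        rw [EventuallyEq, eventually_atTop]
        exact ⟨p, fun x hx ↦ (hzero x hx).symm⟩)
    have := tendsto_nhds_unique (tendsto_singularSeriesPartial_holds H) hlim
    linarith
  · intro hadm
    have hpos : ∀ n, 0 < singularSeriesFactorNat H n := by
      intro n
      rw [singularSeriesFactorNat_def]
      split_ifs with hn
      · exact singularSeriesFactor_pos H hn (hadm n hn)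
      · exact one_pos
    have hlog : Summable fun n ↦ Real.log (singularSeriesFactorNat H n) := by
      have := Real.summable_log_one_add_of_summable
        (summable_norm_singularSeriesFactorNat_sub_one H).of_norm
      simpa using this
    rw [singularSeries_eq_tprod, ← Real.rexp_tsum_eq_tprod hpos hlog]
    exact Real.exp_pos _

end Proofs

end Literature.NumberTheory.Sieve
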